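import Mathlib
import HarnessLib
import Summits.AtomisticToContinuum.Crystallization.Theorems.HolmgrenBoyleLindHalfSpaceUniqueContinuationLayerSlices
import Summits.AtomisticToContinuum.Crystallization.Theorems.HolmgrenBoyleLindHalfSpaceUniqueContinuationLayerOrbits
import Summits.AtomisticToContinuum.Crystallization.Theorems.HolmgrenBoyleLindHalfSpaceUniqueContinuationVerticalModeLaplace
import Summits.AtomisticToContinuum.Crystallization.Theorems.HolmgrenBoyleLindHalfSpaceUniqueContinuationNormalLineModes
import Summits.AtomisticToContinuum.Crystallization.Theorems.HolmgrenBoyleLindHalfSpaceUniqueContinuationInterfaceObservers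
import Summits.AtomisticToContinuum.Crystallization.Theorems.HolmgrenBoyleLindHalfSpaceUniqueContinuationShellPeelingCore

/-!
# Route `HolmgrenBoyleLind`: Lennard-Jones force fields of separated sources, part 20a —
THICK-COLUMN RIGIDITY I: a clean column kills the shell sums of the vertical modes

Support file for the crux item stmt-AtomisticToContinuum-6075 (`HalfSpaceUniqueContinuation`, line
`registered`, layered core; written by lead c3). SETTING as in parts 14/17: a unit normal `u`, a
rank-2 lattice `Λ` of `W = (ℝ ∙ u)ᗮ`, a signed `Λ`-invariant `δ`-separated source `(Dp, +), (Dm, −)`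
in `{⟪y, u⟫ ≥ a}`, its representatives `q` (heights `⟪q, u⟫ − a ≥ 0`), torus characters `e_k` and
dual vectors `w_k`.

* `hbl_modes_hasSum_zero_of_zero` — a zero of the `e`-component of the signed field at
  `b₀ + (a − X) u` is a vanishing mode sum `∑ₖ (∑_q ε_q e_{−k}(P q) 𝓕[slice^e_q](w_k)) e_k(b₀) = 0`
  (part 14);
* **`hbl_vshells_eq_zero_of_column'`** (+ registered `∀`-form `hbl_vshells_eq_zero_of_column`) —
  if the VERTICAL component vanishes along the whole open column `b₀ + (a − X) u`, `X > X₁`, then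
  every height fibre is sign-balanced and, for `k ≠ 0`, the `e_{k'}(b₀)`-weighted sum over the
  shell `‖w_{k'}‖ = ‖w_k‖` of the signed structure factors of every height fibre vanishes: the
  vertical profiles of part 15 turn the mode sums into the hypothesis of the shell-peeling core
  `hbl_shellSums_eq_zero_of_modeSum_eq_zero'` (part 18) with `ν = (3, 6)`,
  `a(r) = −(π/6)(πr)³`, `b(r) = (π/720)(πr)⁶`, `c₀ = 1`, `A = π⁷`.
All `[folklore]`; nothing here closes an item.
-/

noncomputable section

namespace Summit.AtomisticToContinuum.Crystallization.Theorems.HolmgrenBoyleLind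

open scoped BigOperators Topology InnerProductSpace RealInnerProductSpace FourierTransform
open MeasureTheory Filter Set Literature.Algebra.EuclideanLattices.LatticePeriodic
  Literature.Analysis.SpecialFunctions
open scoped Classical


/-! ## From a clean thick column to vanishing shell sums -/

section Column

variable {u : EuclideanSpace ℝ (Fin 3)} (hu : ‖u‖ = 1) (Λ : Submodule ℤ (ℝ ∙ u)ᗮ)
  [DiscreteTopology Λ] [IsZLattice ℝ Λ] {Dp Dm : Set (EuclideanSpace ℝ (Fin 3))} {δ a : ℝ}
  (hδ : 0 < δ) (hdisj : Disjoint Dp Dm)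
  (hsepp : ∀ x ∈ Dp, ∀ y ∈ Dp, x ≠ y → δ ≤ dist x y)
  (hsepm : ∀ x ∈ Dm, ∀ y ∈ Dm, x ≠ y → δ ≤ dist x y)
  (hap : ∀ y ∈ Dp, a ≤ ⟪y, u⟫) (ham : ∀ y ∈ Dm, a ≤ ⟪y, u⟫)
  (hDp : ∀ ℓ : Λ, ∀ y : EuclideanSpace ℝ (Fin 3),
    y + ((ℓ : (ℝ ∙ u)ᗮ) : EuclideanSpace ℝ (Fin 3)) ∈ Dp ↔ y ∈ Dp)
  (hDm : ∀ ℓ : Λ, ∀ y : EuclideanSpace ℝ (Fin 3),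
    y + ((ℓ : (ℝ ∙ u)ᗮ) : EuclideanSpace ℝ (Fin 3)) ∈ Dm ↔ y ∈ Dm)

include hu hδ hsepp hsepm hap ham hDp hDm in
/-- **A zero of a field component is a vanishing mode sum.** If the `e`-component of the signed
field vanishes at the point `b₀ + (a − X) u` (`X > 0`), then the mode series of part 14,
multiplied by the covolume, sums to `0`:
`∑ₖ (∑_q ε_q e_{−k}(P q) 𝓕[slice^e_q](w_k)) e_k(b₀) = 0`. [folklore] -/
theorem hbl_modes_hasSum_zero_of_zero (e : EuclideanSpace ℝ (Fin 3)) (b₀ : (ℝ ∙ u)ᗮ) {X : ℝ}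
    (hX : 0 < X)
    (hzero : (∑' yy : ↥(Dp ∪ Dm), (if (yy : EuclideanSpace ℝ (Fin 3)) ∈ Dp then (1 : ℂ) else -1) *
        ((⟪e, ((((‖((b₀ : EuclideanSpace ℝ (Fin 3)) + (a - X) • u) - (yy : EuclideanSpace ℝ (Fin 3))‖ ^ 2) ^ 4)⁻¹ -
            ((‖((b₀ : EuclideanSpace ℝ (Fin 3)) + (a - X) • u) - (yy : EuclideanSpace ℝ (Fin 3))‖ ^ 2) ^ 7)⁻¹) •
              (((b₀ : EuclideanSpace ℝ (Fin 3)) + (a - X) • u) - (yy : EuclideanSpace ℝ (Fin 3))))⟫ : ℝ) : ℂ)) = 0) :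
    HasSum (fun k : Fin (Module.finrank ℝ (ℝ ∙ u)ᗮ) → ℤ =>
      (∑' q : {q : EuclideanSpace ℝ (Fin 3) //
            q ∈ Dp ∪ Dm ∧ (ℝ ∙ u)ᗮ.orthogonalProjectionOnto q ∈ fdom Λ},
          (if ((q : EuclideanSpace ℝ (Fin 3)) ∈ Dp) then (1 : ℂ) else -1) *
            echar Λ (-k) ((ℝ ∙ u)ᗮ.orthogonalProjectionOnto (q : EuclideanSpace ℝ (Fin 3))) *
            𝓕 (fun v : (ℝ ∙ u)ᗮ =>
              ((((⟪(ℝ ∙ u)ᗮ.orthogonalProjectionOnto e, v⟫ +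
                    (-(X + (⟪(q : EuclideanSpace ℝ (Fin 3)), u⟫ - a))) * ⟪e, u⟫) *
                  ((‖v‖ ^ 2 + (-(X + (⟪(q : EuclideanSpace ℝ (Fin 3)), u⟫ - a))) ^ 2) ^ (-(4 : ℝ)) -
                    (‖v‖ ^ 2 + (-(X + (⟪(q : EuclideanSpace ℝ (Fin 3)), u⟫ - a))) ^ 2) ^
                      (-(7 : ℝ)))) : ℝ) : ℂ)) (dualVec Λ k)) *
        echar Λ k b₀) 0 := by
  have H := hbl_signedField_hasSum_modes' hu Λ hδ hsepp hsepm hap ham hDp hDm e b₀ hX _ rfl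
  rw [hzero] at H
  have hcov : (volume.real (fdom Λ)) ≠ 0 := (measureReal_fdom_pos Λ volume).ne'
  have hcov' : (((volume.real (fdom Λ)) : ℝ) : ℂ) ≠ 0 := by exact_mod_cast hcov
  have H2 := H.mul_left (((volume.real (fdom Λ)) : ℝ) : ℂ)
  rw [mul_zero] at H2
  refine H2.congr_fun fun k => ?_
  simp only [← mul_assoc]
  rw [Complex.ofReal_inv, mul_inv_cancel₀ hcov', one_mul]


set_option maxHeartbeats 1600000 in
include hu hδ hsepp hsepm hap ham hDp hDm in
/-- **A clean column kills the shell sums of the vertical modes.** If the vertical component of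
the signed field vanishes at every point `b₀ + (a − X) u`, `X > X₁ > 0`, of a normal column, then
(i) every height fibre of the representatives is sign-balanced (`∑_{q ∈ T} ε_q = 0`), and (ii) for
every non-zero frequency `k` and every height fibre `T`, the `e_{k'}(b₀)`-weighted sum over the
shell `‖w_{k'}‖ = ‖w_k‖` of the signed structure factors `∑_{q ∈ T} ε_q e_{−k'}(P q)` vanishes
(mode expansion of part 14, vertical profiles of part 15, shell peeling of part 18). [folklore] -/
theorem hbl_vshells_eq_zero_of_column' (b₀ : (ℝ ∙ u)ᗮ) {X₁ : ℝ} (hX₁ : 0 < X₁)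
    (hcol : ∀ X : ℝ, X₁ < X →
      (∑' yy : ↥(Dp ∪ Dm), (if (yy : EuclideanSpace ℝ (Fin 3)) ∈ Dp then (1 : ℂ) else -1) *
        ((⟪u, ((((‖((b₀ : EuclideanSpace ℝ (Fin 3)) + (a - X) • u) - (yy : EuclideanSpace ℝ (Fin 3))‖ ^ 2) ^ 4)⁻¹ -
            ((‖((b₀ : EuclideanSpace ℝ (Fin 3)) + (a - X) • u) - (yy : EuclideanSpace ℝ (Fin 3))‖ ^ 2) ^ 7)⁻¹) •
              (((b₀ : EuclideanSpace ℝ (Fin 3)) + (a - X) • u) - (yy : EuclideanSpace ℝ (Fin 3))))⟫ : ℝ) : ℂ)) = 0) :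
    (∀ (η : ℝ) (T : Finset {q : EuclideanSpace ℝ (Fin 3) //
        q ∈ Dp ∪ Dm ∧ (ℝ ∙ u)ᗮ.orthogonalProjectionOnto q ∈ fdom Λ}),
      (∀ q, q ∈ T ↔ ⟪(q : EuclideanSpace ℝ (Fin 3)), u⟫ = η) →
      ∑ q ∈ T, (if ((q : EuclideanSpace ℝ (Fin 3)) ∈ Dp) then (1 : ℂ) else -1) = 0) ∧
    ∀ (k : Fin (Module.finrank ℝ (ℝ ∙ u)ᗮ) → ℤ), k ≠ 0 → ∀ (η : ℝ)
      (T : Finset {q : EuclideanSpace ℝ (Fin 3) //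
        q ∈ Dp ∪ Dm ∧ (ℝ ∙ u)ᗮ.orthogonalProjectionOnto q ∈ fdom Λ}),
      (∀ q, q ∈ T ↔ ⟪(q : EuclideanSpace ℝ (Fin 3)), u⟫ = η) →
      ∑ k' ∈ (finite_norm_dualVec_le Λ ‖dualVec Λ k‖).toFinset with ‖dualVec Λ k'‖ = ‖dualVec Λ k‖,
        echar Λ k' b₀ * ∑ q ∈ T, (if ((q : EuclideanSpace ℝ (Fin 3)) ∈ Dp) then (1 : ℂ) else -1) *
          echar Λ (-k') ((ℝ ∙ u)ᗮ.orthogonalProjectionOnto (q : EuclideanSpace ℝ (Fin 3))) = 0 := by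
  classical
  -- the index type of representatives, heights, window count
  haveI hR : Countable {q : EuclideanSpace ℝ (Fin 3) //
      q ∈ Dp ∪ Dm ∧ (ℝ ∙ u)ᗮ.orthogonalProjectionOnto q ∈ fdom Λ} :=
    hbl_countable_signedReps Λ hδ hsepp hsepm
  have hy : ∀ q : {q : EuclideanSpace ℝ (Fin 3) //
      q ∈ Dp ∪ Dm ∧ (ℝ ∙ u)ᗮ.orthogonalProjectionOnto q ∈ fdom Λ},
      0 ≤ ⟪(q : EuclideanSpace ℝ (Fin 3)), u⟫ - a := by
    intro q
    rcases q.2.1 with h | h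
    · linarith [hap _ h]
    · linarith [ham _ h]
  obtain ⟨N, hNc⟩ := hbl_exists_reps_height_count hu Λ hδ
  have hN : ∀ j : ℕ, {q : {q : EuclideanSpace ℝ (Fin 3) //
      q ∈ Dp ∪ Dm ∧ (ℝ ∙ u)ᗮ.orthogonalProjectionOnto q ∈ fdom Λ} |
        (j : ℝ) ≤ ⟪(q : EuclideanSpace ℝ (Fin 3)), u⟫ - a ∧
          ⟪(q : EuclideanSpace ℝ (Fin 3)), u⟫ - a ≤ j + 1}.encard ≤ (N + N : ℕ) := by
    intro j
    set A := {q : {q : EuclideanSpace ℝ (Fin 3) //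
      q ∈ Dp ∪ Dm ∧ (ℝ ∙ u)ᗮ.orthogonalProjectionOnto q ∈ fdom Λ} |
        (j : ℝ) ≤ ⟪(q : EuclideanSpace ℝ (Fin 3)), u⟫ - a ∧
          ⟪(q : EuclideanSpace ℝ (Fin 3)), u⟫ - a ≤ j + 1} with hA
    have himg : (Subtype.val '' A) ⊆
        {q : EuclideanSpace ℝ (Fin 3) | (q ∈ Dp ∧ (ℝ ∙ u)ᗮ.orthogonalProjectionOnto q ∈ fdom Λ) ∧
          (a + j) ≤ ⟪q, u⟫ ∧ ⟪q, u⟫ ≤ (a + j) + 1} ∪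
        {q : EuclideanSpace ℝ (Fin 3) | (q ∈ Dm ∧ (ℝ ∙ u)ᗮ.orthogonalProjectionOnto q ∈ fdom Λ) ∧
          (a + j) ≤ ⟪q, u⟫ ∧ ⟪q, u⟫ ≤ (a + j) + 1} := by
      rintro x ⟨q, ⟨h1, h2⟩, rfl⟩
      rcases q.2.1 with h | h
      · exact Or.inl ⟨⟨h, q.2.2⟩, by linarith, by linarith⟩
      · exact Or.inr ⟨⟨h, q.2.2⟩, by linarith, by linarith⟩
    calc A.encard = (Subtype.val '' A).encard := (Subtype.val_injective.encard_image A).symm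
      _ ≤ _ := Set.encard_le_encard himg
      _ ≤ _ := Set.encard_union_le _ _
      _ ≤ (N : ℕ∞) + N := add_le_add (hNc Dp hsepp (a + j)) (hNc Dm hsepm (a + j))
      _ = ((N + N : ℕ) : ℕ∞) := by push_cast; rfl
  -- frequency data
  have hu0 : u ≠ 0 := by
    intro h0; rw [h0, norm_zero] at hu; exact zero_ne_one hu
  have hV : Module.finrank ℝ (ℝ ∙ u)ᗮ = 2 := hbl_finrank_orthogonal_span_singleton hu0
  obtain ⟨κ, hκ, hκle⟩ := hbl_exists_norm_dualVec_lb Λ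
  have hρ0 : ‖dualVec Λ (0 : Fin (Module.finrank ℝ (ℝ ∙ u)ᗮ) → ℤ)‖ = 0 := by
    rw [hbl_dualVec_zero, norm_zero]
  have hρ : ∀ k : Fin (Module.finrank ℝ (ℝ ∙ u)ᗮ) → ℤ, k ≠ 0 → 0 < ‖dualVec Λ k‖ :=
    fun k hk => hκ.trans_le (hκle k hk)
  have hexp : ∀ ε : ℝ, 0 < ε →
      Summable fun k : Fin (Module.finrank ℝ (ℝ ∙ u)ᗮ) → ℤ => Real.exp (-(ε * ‖dualVec Λ k‖)) :=
    fun ε hε => (summable_exp_neg_mul_norm_dualVec Λ hε).congr fun k => by ring_nf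
  have hψ : ∀ k : Fin (Module.finrank ℝ (ℝ ∙ u)ᗮ) → ℤ, ‖echar Λ k b₀‖ = 1 := fun k => norm_echar Λ k _
  have hθ : ∀ (k : Fin (Module.finrank ℝ (ℝ ∙ u)ᗮ) → ℤ)
      (q : {q : EuclideanSpace ℝ (Fin 3) //
        q ∈ Dp ∪ Dm ∧ (ℝ ∙ u)ᗮ.orthogonalProjectionOnto q ∈ fdom Λ}),
      ‖(if ((q : EuclideanSpace ℝ (Fin 3)) ∈ Dp) then (1 : ℂ) else -1) *
        echar Λ (-k) ((ℝ ∙ u)ᗮ.orthogonalProjectionOnto (q : EuclideanSpace ℝ (Fin 3)))‖ ≤ 1 := by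
    intro k q
    rw [norm_mul, norm_echar, mul_one]
    split_ifs <;> simp
  -- the coefficient functions of the vertical profiles
  have ha : ∀ r : ℝ, 0 < r → (fun r : ℝ => -(Real.pi / 6 * (Real.pi * r) ^ 3)) r ≠ 0 := by
    intro r hr
    have : 0 < Real.pi / 6 * (Real.pi * r) ^ 3 := by positivity
    simp only [ne_eq, neg_eq_zero]
    exact this.ne'
  have hab : ∀ r : ℝ, 0 < r →
      |(fun r : ℝ => -(Real.pi / 6 * (Real.pi * r) ^ 3)) r| ≤ Real.pi ^ 7 * Real.exp r ∧
      |(fun r : ℝ => Real.pi / 720 * (Real.pi * r) ^ 6) r| ≤ Real.pi ^ 7 * Real.exp r := by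
    intro r hr
    have hπ1 : (1 : ℝ) ≤ Real.pi := by linarith [Real.pi_gt_three]
    have h3 : r ^ 3 ≤ 6 * Real.exp r := by
      have h := Real.pow_div_factorial_le_exp r hr.le 3
      rw [div_le_iff₀ (by positivity)] at h
      have hf : ((Nat.factorial 3 : ℕ) : ℝ) = 6 := by norm_num [Nat.factorial]
      rw [hf] at h
      linarith
    have h6 : r ^ 6 ≤ 720 * Real.exp r := by
      have h := Real.pow_div_factorial_le_exp r hr.le 6
      rw [div_le_iff₀ (by positivity)] at h
      have hf : ((Nat.factorial 6 : ℕ) : ℝ) = 720 := by norm_num [Nat.factorial]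
      rw [hf] at h
      linarith
    have hπ4 : Real.pi ^ 4 ≤ Real.pi ^ 7 := pow_le_pow_right₀ hπ1 (by norm_num)
    have he : 0 < Real.exp r := Real.exp_pos r
    constructor
    · rw [abs_neg, abs_of_nonneg (by positivity)]
      calc Real.pi / 6 * (Real.pi * r) ^ 3 = Real.pi ^ 4 / 6 * r ^ 3 := by ring
        _ ≤ Real.pi ^ 4 / 6 * (6 * Real.exp r) := by gcongr
        _ = Real.pi ^ 4 * Real.exp r := by ring
        _ ≤ Real.pi ^ 7 * Real.exp r := by gcongr
    · rw [abs_of_nonneg (by positivity)]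
      calc Real.pi / 720 * (Real.pi * r) ^ 6 = Real.pi ^ 7 / 720 * r ^ 6 := by ring
        _ ≤ Real.pi ^ 7 / 720 * (720 * Real.exp r) := by gcongr
        _ = Real.pi ^ 7 * Real.exp r := by ring
  -- the mode sums vanish for `X > X₁`
  have hsum : ∀ X : ℝ, X₁ < X → HasSum (fun k : Fin (Module.finrank ℝ (ℝ ∙ u)ᗮ) → ℤ =>
      echar Λ k b₀ *
      ∑' q : {q : EuclideanSpace ℝ (Fin 3) //
          q ∈ Dp ∪ Dm ∧ (ℝ ∙ u)ᗮ.orthogonalProjectionOnto q ∈ fdom Λ},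
        ((if ((q : EuclideanSpace ℝ (Fin 3)) ∈ Dp) then (1 : ℂ) else -1) *
          echar Λ (-k) ((ℝ ∙ u)ᗮ.orthogonalProjectionOnto (q : EuclideanSpace ℝ (Fin 3)))) *
        (if k = 0 then
          (((1 : ℝ) * (-(Real.pi * ((X + (⟪(q : EuclideanSpace ℝ (Fin 3)), u⟫ - a))⁻¹ ^ 5 / 3 -
            (X + (⟪(q : EuclideanSpace ℝ (Fin 3)), u⟫ - a))⁻¹ ^ 11 / 6))) : ℝ) : ℂ)
        else
          (((fun r : ℝ => -(Real.pi / 6 * (Real.pi * r) ^ 3)) ‖dualVec Λ k‖ *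
              (((X + (⟪(q : EuclideanSpace ℝ (Fin 3)), u⟫ - a)) ^ (-(2 : ℝ)) : ℝ) *
                ∫ w : ℝ, Real.exp (3 * w - 2 * Real.pi * ‖dualVec Λ k‖ *
                  (X + (⟪(q : EuclideanSpace ℝ (Fin 3)), u⟫ - a)) * Real.cosh w)) +
            (fun r : ℝ => Real.pi / 720 * (Real.pi * r) ^ 6) ‖dualVec Λ k‖ *
              (((X + (⟪(q : EuclideanSpace ℝ (Fin 3)), u⟫ - a)) ^ (-(5 : ℝ)) : ℝ) *
                ∫ w : ℝ, Real.exp (6 * w - 2 * Real.pi * ‖dualVec Λ k‖ *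
                  (X + (⟪(q : EuclideanSpace ℝ (Fin 3)), u⟫ - a)) * Real.cosh w)) :
            ℝ) : ℂ))) 0 := by
    intro X hX
    have hX0 : 0 < X := hX₁.trans hX
    have H := hbl_modes_hasSum_zero_of_zero hu Λ hδ hsepp hsepm hap ham hDp hDm u b₀ hX0
      (hcol X hX)
    refine H.congr_fun fun k => ?_
    -- the slice of the vertical component and its transform
    have hPu : (ℝ ∙ u)ᗮ.orthogonalProjectionOnto u = 0 :=
      Submodule.orthogonalProjectionOnto_orthogonalComplement_singleton_eq_zero u
    have huu : ⟪u, u⟫ = 1 := by rw [real_inner_self_eq_norm_sq, hu, one_pow]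
    have hterm : ∀ q : {q : EuclideanSpace ℝ (Fin 3) //
        q ∈ Dp ∪ Dm ∧ (ℝ ∙ u)ᗮ.orthogonalProjectionOnto q ∈ fdom Λ},
        𝓕 (fun v : (ℝ ∙ u)ᗮ =>
          ((((⟪(ℝ ∙ u)ᗮ.orthogonalProjectionOnto u, v⟫ +
                (-(X + (⟪(q : EuclideanSpace ℝ (Fin 3)), u⟫ - a))) * ⟪u, u⟫) *
              ((‖v‖ ^ 2 + (-(X + (⟪(q : EuclideanSpace ℝ (Fin 3)), u⟫ - a))) ^ 2) ^ (-(4 : ℝ)) -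
                (‖v‖ ^ 2 + (-(X + (⟪(q : EuclideanSpace ℝ (Fin 3)), u⟫ - a))) ^ 2) ^ (-(7 : ℝ)))) :
            ℝ) : ℂ)) (dualVec Λ k) =
        (if k = 0 then
          (((1 : ℝ) * (-(Real.pi * ((X + (⟪(q : EuclideanSpace ℝ (Fin 3)), u⟫ - a))⁻¹ ^ 5 / 3 -
            (X + (⟪(q : EuclideanSpace ℝ (Fin 3)), u⟫ - a))⁻¹ ^ 11 / 6))) : ℝ) : ℂ)
        else
          (((fun r : ℝ => -(Real.pi / 6 * (Real.pi * r) ^ 3)) ‖dualVec Λ k‖ *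
              (((X + (⟪(q : EuclideanSpace ℝ (Fin 3)), u⟫ - a)) ^ (-(2 : ℝ)) : ℝ) *
                ∫ w : ℝ, Real.exp (3 * w - 2 * Real.pi * ‖dualVec Λ k‖ *
                  (X + (⟪(q : EuclideanSpace ℝ (Fin 3)), u⟫ - a)) * Real.cosh w)) +
            (fun r : ℝ => Real.pi / 720 * (Real.pi * r) ^ 6) ‖dualVec Λ k‖ *
              (((X + (⟪(q : EuclideanSpace ℝ (Fin 3)), u⟫ - a)) ^ (-(5 : ℝ)) : ℝ) *
                ∫ w : ℝ, Real.exp (6 * w - 2 * Real.pi * ‖dualVec Λ k‖ *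
                  (X + (⟪(q : EuclideanSpace ℝ (Fin 3)), u⟫ - a)) * Real.cosh w)) :
            ℝ) : ℂ)) := by
      intro q
      have ht : 0 < X + (⟪(q : EuclideanSpace ℝ (Fin 3)), u⟫ - a) :=
        add_pos_of_pos_of_nonneg hX0 (hy q)
      have hfun : (fun v : (ℝ ∙ u)ᗮ =>
          ((((⟪(ℝ ∙ u)ᗮ.orthogonalProjectionOnto u, v⟫ +
                (-(X + (⟪(q : EuclideanSpace ℝ (Fin 3)), u⟫ - a))) * ⟪u, u⟫) *
              ((‖v‖ ^ 2 + (-(X + (⟪(q : EuclideanSpace ℝ (Fin 3)), u⟫ - a))) ^ 2) ^ (-(4 : ℝ)) -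
                (‖v‖ ^ 2 + (-(X + (⟪(q : EuclideanSpace ℝ (Fin 3)), u⟫ - a))) ^ 2) ^ (-(7 : ℝ)))) :
            ℝ) : ℂ)) =
          fun v : (ℝ ∙ u)ᗮ => (((-(X + (⟪(q : EuclideanSpace ℝ (Fin 3)), u⟫ - a))) *
            ((‖v‖ ^ 2 + (X + (⟪(q : EuclideanSpace ℝ (Fin 3)), u⟫ - a)) ^ 2) ^ (-(4 : ℝ)) -
              (‖v‖ ^ 2 + (X + (⟪(q : EuclideanSpace ℝ (Fin 3)), u⟫ - a)) ^ 2) ^ (-(7 : ℝ))) :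
            ℝ) : ℂ) := by
        funext v
        rw [hPu, huu, neg_sq]
        simp
      rw [hfun]
      by_cases hk : k = 0
      · rw [if_pos hk, hk, hbl_dualVec_zero, hbl_fourier_verticalSlice_zero hV ht, one_mul]
      · have hw : dualVec Λ k ≠ 0 := fun h0 => (hρ k hk).ne' (by rw [h0, norm_zero])
        rw [if_neg hk, hbl_fourier_verticalSlice hV ht hw]
    simp_rw [hterm]
    rw [← tsum_mul_right]
    rw [← tsum_mul_left]
    refine tsum_congr fun q => ?_
    ring
  have core := hbl_shellSums_eq_zero_of_modeSum_eq_zero' (0 : Fin (Module.finrank ℝ (ℝ ∙ u)ᗮ) → ℤ)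
    (fun k => ‖dualVec Λ k‖) hρ0 hρ (fun C => finite_norm_dualVec_le Λ C) hexp
    (fun k => echar Λ k b₀) hψ
    (fun k (q : {q : EuclideanSpace ℝ (Fin 3) //
        q ∈ Dp ∪ Dm ∧ (ℝ ∙ u)ᗮ.orthogonalProjectionOnto q ∈ fdom Λ}) =>
      (if ((q : EuclideanSpace ℝ (Fin 3)) ∈ Dp) then (1 : ℂ) else -1) *
      echar Λ (-k) ((ℝ ∙ u)ᗮ.orthogonalProjectionOnto (q : EuclideanSpace ℝ (Fin 3))))
    hθ (fun q => ⟪(q : EuclideanSpace ℝ (Fin 3)), u⟫ - a) hy hN 3 6 1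
    (fun r : ℝ => -(Real.pi / 6 * (Real.pi * r) ^ 3)) (fun r : ℝ => Real.pi / 720 * (Real.pi * r) ^ 6)
    ha hab hX₁ hsum
  -- identify the fibre Finsets with `T`
  have hTeq : ∀ (η : ℝ) (T : Finset {q : EuclideanSpace ℝ (Fin 3) //
        q ∈ Dp ∪ Dm ∧ (ℝ ∙ u)ᗮ.orthogonalProjectionOnto q ∈ fdom Λ}),
      (∀ q, q ∈ T ↔ ⟪(q : EuclideanSpace ℝ (Fin 3)), u⟫ = η) →
      T = Finset.filter
        (fun q : {q : EuclideanSpace ℝ (Fin 3) //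
          q ∈ Dp ∪ Dm ∧ (ℝ ∙ u)ᗮ.orthogonalProjectionOnto q ∈ fdom Λ} =>
          ⟪(q : EuclideanSpace ℝ (Fin 3)), u⟫ - a = η - a)
        (hbl_shell_heights_finite hN hy (η - a)).toFinset := by
    intro η T hT
    ext q
    rw [hT q, Finset.mem_filter, Set.Finite.mem_toFinset, Set.mem_setOf_eq]
    constructor
    · intro h
      exact ⟨by rw [h], by rw [h]⟩
    · intro h
      linarith [h.2]
  constructor
  · intro η T hT
    have h0 := core.1 one_ne_zero (η - a)
    rw [hTeq η T hT]
    simpa only [neg_zero, echar_zero, mul_one] using h0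
  · intro k hk η T hT
    have h1 := core.2 k hk (η - a)
    rw [hTeq η T hT]
    exact h1


end Column

/-- **A clean column kills the shell sums of the vertical modes** (registered `∀`-form of
`hbl_vshells_eq_zero_of_column'`). [folklore] -/
theorem hbl_vshells_eq_zero_of_column : ∀ {u : EuclideanSpace ℝ (Fin 3)} (hu : ‖u‖ = 1) (Λ : Submodule ℤ (ℝ ∙ u)ᗮ) [DiscreteTopology Λ] [IsZLattice ℝ Λ] {Dp Dm : Set (EuclideanSpace ℝ (Fin 3))} {δ a : ℝ} (hδ : 0 < δ), (∀ x ∈ Dp, ∀ y ∈ Dp, x ≠ y → δ ≤ dist x y) → (∀ x ∈ Dm, ∀ y ∈ Dm, x ≠ y → δ ≤ dist x y) → (∀ y ∈ Dp, a ≤ inner ℝ y u) → (∀ y ∈ Dm, a ≤ inner ℝ y u) → (∀ ℓ : Λ, ∀ y : EuclideanSpace ℝ (Fin 3), y + ((ℓ : (ℝ ∙ u)ᗮ) : EuclideanSpace ℝ (Fin 3)) ∈ Dp ↔ y ∈ Dp) → (∀ ℓ : Λ, ∀ y : EuclideanSpace ℝ (Fin 3), y + ((ℓ : (ℝ ∙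 u)ᗮ) : EuclideanSpace ℝ (Fin 3)) ∈ Dm ↔ y ∈ Dm) → ∀ (b₀ : (ℝ ∙ u)ᗮ) {X₁ : ℝ}, 0 < X₁ → (∀ X : ℝ, X₁ < X → (∑' yy : ↥(Dp ∪ Dm), (if (yy : EuclideanSpace ℝ (Fin 3)) ∈ Dp then (1 : ℂ) else -1) * ((inner ℝ u (((((‖((b₀ : EuclideanSpace ℝ (Fin 3)) + (a - X) • u) - (yy : EuclideanSpace ℝ (Fin 3))‖ ^ 2) ^ 4)⁻¹ - ((‖((b₀ : EuclideanSpace ℝ (Fin 3)) + (a - X) • u) - (yy : EuclideanSpace ℝ (Fin 3))‖ ^ 2) ^ 7)⁻¹) • (((b₀ : EuclideanSpace ℝ (Fin 3)) + (a - X) • u) - (yy : EuclideanSpace ℝ (Fin 3))))) : ℝ) : ℂ)) = 0) → (∀ (η : ℝ) (T : Finset {q : EuclideanSpace ℝ (Fin 3) // q ∈ Dp ∪ Dm ∧ (ℝ ∙ u)ᗮ.orthogonalProjectionOnto q ∈ Literature.Algebra.EuclideanLattices.LatticePeriodic.fdom Λ}), (∀ q, q ∈ T ↔ inner ℝ (q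 : EuclideanSpace ℝ (Fin 3)) u = η) → ∑ q ∈ T, (if ((q : EuclideanSpace ℝ (Fin 3)) ∈ Dp) then (1 : ℂ) else -1) = 0) ∧ ∀ (k : Fin (Module.finrank ℝ (ℝ ∙ u)ᗮ) → ℤ), k ≠ 0 → ∀ (η : ℝ) (T : Finset {q : EuclideanSpace ℝ (Fin 3) // q ∈ Dp ∪ Dm ∧ (ℝ ∙ u)ᗮ.orthogonalProjectionOnto q ∈ Literature.Algebra.EuclideanLattices.LatticePeriodic.fdom Λ}), (∀ q, q ∈ T ↔ inner ℝ (q : EuclideanSpace ℝ (Fin 3)) u = η) → ∑ k' ∈ (Literature.Algebra.EuclideanLattices.LatticePeriodic.finite_norm_dualVec_le Λ ‖Literature.Algebra.EuclideanLattices.LatticePeriodic.dualVec Λ k‖).toFinset with ‖Literature.Algebra.EuclideanLattices.LatticePeriodic.dualVec Λ k'‖ = ‖Literature.Algebra.EuclideanLattices.LatticePeriodic.dualVec Λ k‖, Literature.Algebra.EuclideanLattices.LatticePeriodic.echar Λ k' b₀ * ∑ q ∈ T, (if ((q : EuclideanSpace ℝ (Fin 3)) ∈ Dp) then (1 : ℂ)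 else -1) * Literature.Algebra.EuclideanLattices.LatticePeriodic.echar Λ (-k') ((ℝ ∙ u)ᗮ.orthogonalProjectionOnto (q : EuclideanSpace ℝ (Fin 3))) = 0 := by
  intro u hu Λ _ _ Dp Dm δ a hδ hsepp hsepm hap ham hDp hDm b₀ X₁ hX₁ hcol
  exact hbl_vshells_eq_zero_of_column' hu Λ hδ hsepp hsepm hap ham hDp hDm b₀ hX₁ hcol

end Summit.AtomisticToContinuum.Crystallization.Theorems.HolmgrenBoyleLind

end
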